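/-
Copyright (c) 2026 the pub-hodgecm-mathlib formalisation cell (harness21).  Prover seat hodgecm-mathlib-LH4-p07 (g9), req620 Track A «(D-RAM) FOUR-FRAME» squad
(STAGE-1b, row-(2) lineage; dealer LH4-plan (g13) WORD #58 RULING A ∕ #59 ∕ #64 ∕ #65 ∕ #69 (4): owner of the two-literal census law of `lev_{a,m}`), 2026-09-04.
-/
import Summits.HodgeConjecture.HodgeConjecture.Theorems.F0P3cDyRamLevelsCensusGuardedCM          -- ★ p859485 (LH4-p04 (g7)): §1 `…_levels_eq_guardedForm`, §2 `…_conj_endoGL_levels_eq_guardedForm` (generic guard)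
import Summits.HodgeConjecture.HodgeConjecture.Theorems.F0P3cDyRamToricLevelCensusRamMOddDepth      -- ★ (LH4-p08 (g9), (R0)): `finsum_mem_inter_levelSetDep_eq_ramified_odd` (odd-depth second multiplier: guard `j + a ≤ m₂`)
import Summits.HodgeConjecture.HodgeConjecture.Theorems.F0P3cDyRamLevelsCensusCutoffCMRamM          -- ★ p860481 (this seat): §0 `sum_ite_isOrd₃_eq_sum_range_of_deep'` (lane-free rows)
import Summits.HodgeConjecture.HodgeConjecture.Theorems.F0P3cDyRamJointProfileCensusCutoff        -- ★ p859713 (this seat): `guard_iff_cutoff_unr`, `add_sub_two_sub_map_eq`, `v_sub_map_le`; brings GUARD LETTER + axis tables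
import HarnessLib

/-!
# Crux `H413`, line LH4 «(D-RAM) FOUR-FRAME» — STAGE-1b, row (2): (C2-lev-cutoff-CM-RamM, ODD) «THE LEVEL-PIECE CENSUS AT THE CM PLACE, TYPE RamM, ODD-DEPTH SQUARE MULTIPLIER»
# `cnt_{a,b}(Γ) = Σ_{j ≤ jl − a} #levelSet(j, 0) + Σ_{b′ ∈ Icc 1 R} Σ_{j ≤ jl − a} [j + b′ ≤ m₂]·Σᶠ_{Λ ∈ levelSetDep(j, b′; μ₁)} f b′ j Λ`

Cell `hodgecm-mathlib` (D-0151), FLOOR 0, crux item H413 = `stmt-HodgeConjecture-24833`, route of record `HCCMUnconditional`; squad F0∕P3c∕LH4; lane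
`--supports stmt-HodgeConjecture-24833 --as helper` (count-neutral; pays NO tier-0 row).  THEOREMS ONLY (no `def`, no instance, no notation, no `sorry`, default heartbeats).
OWNER'S ORGAN №20 — the ODD-kν companion of ★ p860481: on type RamM the square multiplier `μ₂ = (jEϖ^b)⁻¹((lam − 1)² − jE((u₀₀ − 1)²))` may have ODD valuation
`|μ₂| = |jEϖ|^{m₂}·|α|` (the trace-level token `kν` odd); LH4-p08 (g9)'s (R0) ★ `finsum_mem_inter_levelSetDep_eq_ramified_odd` shows the two-multiplier cell is then the
one-multiplier cell behind the BARE cutoff `j + b′ ≤ m₂` (an odd-depth multiplier sees no twist).  Reading ★ p859485 §1∕§2 with that `hcell` and the lane-free rows §0′ of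
★ p860481: §1 **`ncard_typeZero_fixed_endoGL_levels_eq_cutoff_ramM_odd`** (hyperbolic literal) ∕ §2 **`ncard_typeZero_fixed_conj_endoGL_levels_eq_cutoff_ramM_odd`** (anisotropic).
(On this population `kν = 2jλ + 1` and `m₂ = m + jλ − b` — the even population's cutoff; the socket `levelsCensusC` branches on `kν % 2` and meets the same weld.)
HONEST LABEL.  Count-neutral lattice bookkeeping; no census law is stated; `HC_CM` is proved only modulo the 7 printed citations (2 remaining named inputs: hLiu418 =
`stmt-HodgeConjecture-24832`, h413 = `stmt-HodgeConjecture-24833`) until rung 0 closes.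

## References
* [Kottwitz1986BaseChangeUnits] R. E. Kottwitz, *Base change for unit elements of Hecke algebras*, Compositio Math. 60 (1986): §1 pp. 240–241.
* [Rogawski1990] J. D. Rogawski, *Automorphic Representations of Unitary Groups in Three Variables*, Ann. of Math. Stud. 123 (1990): §4.9 Prop. 4.9.1 (a)(b) pp. 54–55, Lemma 4.9.3 p. 56.
* [Jacobowitz1962] R. Jacobowitz, *Hermitian forms over local fields*, Amer. J. Math. 84 (1962): §4.
* [Serre1979] J.-P. Serre, *Local Fields*, GTM 67 (1979): Ch. III §6 Prop. 12.
-/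

set_option autoImplicit false

noncomputable section
namespace Summit.HodgeConjecture.HodgeConjecture.Cruxes.H413.F0P3cDyRamLevelsCensusCutoffCMRamMOdd

open MeasureTheory Measure NumberField IsDedekindDomain Topology Filter
open Literature.NumberTheory.Automorphic Literature.NumberTheory.Automorphic.UnitaryGroup Literature.NumberTheory.Automorphic.IntegralReduction
open Literature.NumberTheory.Rogawski1990 Literature.NumberTheory.GaloisRepresentations
open Literature.NumberTheory.Automorphic.UnitaryThreeFourFrame
open scoped Matrix MatrixGroups Classical Valued WithZero
open Literature.NumberTheory.Automorphic.UnitaryLatticeTree Literature.NumberTheory.Automorphic.HermitianLattice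
open Literature.NumberTheory.Automorphic.EllipticPlaneAsFieldLine
open Literature.NumberTheory.LocalFields.QuadraticOrder
open Summit.HodgeConjecture.HodgeConjecture.Cruxes.H413.F0P3cDyRamToricCensusDefs
open Summit.HodgeConjecture.HodgeConjecture.Cruxes.H413.F0P3cDyRamFourFrameCensusDefs (LatticeInLevel)
open Summit.HodgeConjecture.HodgeConjecture.Cruxes.H413.F0P3cDyRamLevelsCensusGuardedCM
open Summit.HodgeConjecture.HodgeConjecture.Cruxes.H413.F0P3cDyRamToricLevelCensusRamMOddDepth (finsum_mem_inter_levelSetDep_eq_ramified_odd)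
open Summit.HodgeConjecture.HodgeConjecture.Cruxes.H413.F0P3cDyRamLevelsCensusCutoffCMRamM (sum_ite_isOrd₃_eq_sum_range_of_deep')
open Summit.HodgeConjecture.HodgeConjecture.Cruxes.H413.F0P3cDyRamOrderFiltrationRange (isOrd_pow_iff_le)
open Summit.HodgeConjecture.HodgeConjecture.Cruxes.H413.F0P3cDyRamJointProfileCensusAxisTables (sum_ite_isOrd₃_eq_sum_range)
open Summit.HodgeConjecture.HodgeConjecture.Cruxes.H413.F0P3cDyRamJointProfileCensusIndicatorLetter (isOrd_pow_inv_mul_sub_one_iff_le)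

/-! ## §1 The hyperbolic literal -/

/-- **(C2-lev-cutoff-CM-RamM, ODD), HYPERBOLIC LITERAL.**  ★ p859485 §1's binders VERBATIM (universe-`0` `M`) with `hcell :=` ★ (R0) `finsum_mem_inter_levelSetDep_eq_ramified_odd`
under the ramified datum on `M`, `|jEϖ| = exp(−2)` and the ODD square-multiplier token `|μ₂| = |jEϖ|^{m₂}·|α|`, plus the token `jl`, the deep trace token and the level letters;
conclusion: axis rows `j ≤ jl − a` + cone cells of `μ₁` behind the bare cutoff `j + b′ ≤ m₂`. [cite: Serre1979, Ch. III §6 Prop. 12] [cite: Kottwitz1986BaseChangeUnits, §1 pp. 240–241] [cite: Rogawski1990, §4.9 Prop. 4.9.1 (a)(b) pp. 54–55] [cite: Jacobowitz1962, §4] [cite: Flicker1998UnitaryFL, Prop. 7 p. 84] -/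
theorem ncard_typeZero_fixed_endoGL_levels_eq_cutoff_ramM_odd (L : Type) [Field L] [NumberField L] [IsCMField L]
    {v : HeightOneSpectrum (𝓞 ↥(maximalRealSubfield L))} (w : UnitaryGroup.PlacesOver L v)
    (hw : IsCMField.complexConj L • w.1 = w.1) {ϖ : (w.1.adicCompletion L)} (hϖ : Valued.v ϖ = WithZero.exp (-1 : ℤ))
    {M : Type} [Field M] [Valued M ℤᵐ⁰] {ρ Θ : M →+* M} {α : M} (jE : (w.1.adicCompletion L) →+* M)
    (hρρ : ∀ x, ρ (ρ x) = x) (hvρ : ∀ x, Valued.v (ρ x) = Valued.v x) (hα : ρ α ≠ α) (hα1 : Valued.v α ≤ 1)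
    (hint : ∀ z : M, Valued.v z ≤ 1 → Valued.v ((z - ρ z) / (α - ρ α)) ≤ 1)
    (hΘΘ : ∀ x, Θ (Θ x) = x) (hΘρ : ∀ x, Θ (ρ x) = ρ (Θ x)) (hvΘ : ∀ x, Valued.v (Θ x) = Valued.v x)
    (hΘj : ∀ x, Θ (jE x) = jE ((galAdicCompletionMap (L := L) (IsCMField.complexConj L) hw) x))
    (hjv : ∀ c, Valued.v (jE c) ≤ 1 ↔ Valued.v c ≤ 1) (hjfix : ∀ z, ρ z = z ↔ ∃ c, jE c = z)
    (hjpow : ∀ (t : (w.1.adicCompletion L)) (n : ℤ), Valued.v (jE t) = Valued.v (jE ϖ) ^ n ↔ Valued.v t = Valued.v ϖ ^ n)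
    (hEval : ∀ c : M, ρ c = c → c ≠ 0 → Valued.v c ≤ 1 → ∃ n : ℕ, Valued.v c = Valued.v (jE ϖ) ^ n)
    (hϖmax : ∀ t : M, ρ t = t → Valued.v t < 1 → Valued.v t ≤ Valued.v (jE ϖ))
    (φ : (Fin 2 → (w.1.adicCompletion L)) →+ M) (hφs : ∀ (c : (w.1.adicCompletion L)) (x : Fin 2 → (w.1.adicCompletion L)), φ (c • x) = jE c * φ x)
    (hφi : Function.Injective φ) (hφo : Function.Surjective φ)
    (γ₂ : GL (Fin 2) (w.1.adicCompletion L)) {lam h : M} (hφγ : ∀ x, φ ((γ₂ : Matrix (Fin 2) (Fin 2) (w.1.adicCompletion L)).mulVec x) = lam * φ x) (hlam : Valued.v lam = 1)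
    (hΘh : Θ h = h) (hh : h ≠ 0)
    (hform : ∀ x y, jE (pairing (galAdicCompletionMap (L := L) (IsCMField.complexConj L) hw) (placeForm (Matrix.of fun i j : Fin 2 => if i.val + j.val + 1 = 2 then (1 : L) else 0) w.1) x y) =
      h * Θ (φ x) * φ y + ρ (h * Θ (φ x) * φ y))
    (u : GL (Fin 1) (w.1.adicCompletion L))
    (hΓ : endoGL (γ₂, u) ∈ unitaryGroupOfForm (galAdicCompletionMap (L := L) (IsCMField.complexConj L) hw) (placeForm (Matrix.of fun i j : Fin 3 => if i.val + j.val + 1 = 3 then (1 : L) else 0) w.1))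
    (hu : Valued.v ((u : Matrix (Fin 1) (Fin 1) (w.1.adicCompletion L)) 0 0) = 1) (a b : ℕ)
    (huc : Valued.v ((u : Matrix (Fin 1) (Fin 1) (w.1.adicCompletion L)) 0 0 - 1) ≤ Valued.v ϖ ^ a)
    (huc2 : Valued.v (((u : Matrix (Fin 1) (Fin 1) (w.1.adicCompletion L)) 0 0 - 1) ^ 2) ≤ Valued.v ϖ ^ b) {R : ℕ}
    (hfinF : {M₃ : Submodule (Valued.integer (w.1.adicCompletion L)) (Fin 3 → (w.1.adicCompletion L)) |
      IsVertexLattice (galAdicCompletionMap (L := L) (IsCMField.complexConj L) hw) ϖ ((StdForm.antidiagonal 3).over (w.1.adicCompletion L)) 0 M₃ ∧ mapGL (endoGL (γ₂, u)) M₃ = M₃}.Finite)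
    (hR : ∀ M₃ : Submodule (Valued.integer (w.1.adicCompletion L)) (Fin 3 → (w.1.adicCompletion L)),
      IsVertexLattice (galAdicCompletionMap (L := L) (IsCMField.complexConj L) hw) ϖ ((StdForm.antidiagonal 3).over (w.1.adicCompletion L)) 0 M₃ →
      mapGL (endoGL (γ₂, u)) M₃ = M₃ → ∀ b' : ℕ, (∀ c : (w.1.adicCompletion L), (Pi.single 1 c : Fin 3 → (w.1.adicCompletion L)) ∈ M₃ ↔ Valued.v c ≤ Valued.v ϖ ^ b') → b' ≤ R)
    {J : ℕ} (hJ : ¬ IsOrd ρ α (jE ϖ ^ (J + 1)) lam) (hfinLS : ∀ j a', (levelSet ρ Θ α (jE ϖ) h j a').Finite)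
    (f : ℕ → ℕ → AddSubgroup M → ℕ)
    (hf : ∀ (b' j : ℕ) (Λ : AddSubgroup M) (x₀ : M) (r : (w.1.adicCompletion L)), 1 ≤ b' → x₀ ≠ 0 →
      (∀ x, x ∈ Λ ↔ ∃ z, IsOrd ρ α (jE ϖ ^ j) z ∧ x = x₀ * z) →
      IsOrd ρ α (jE ϖ ^ j) (dualGen ρ Θ α (jE ϖ ^ j) h x₀) → ¬ IsOrd ρ α (jE ϖ ^ j) (dualGen ρ Θ α (jE ϖ ^ j) h x₀ / jE ϖ) →
      Valued.v (dualGen ρ Θ α (jE ϖ ^ j) h x₀) = Valued.v (jE ϖ) ^ b' →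
      (∀ b'', (∀ x ∈ Λ, Valued.v (h * Θ x * b'' + ρ (h * Θ x * b'')) ≤ 1) → (lam - jE ((u : Matrix (Fin 1) (Fin 1) (w.1.adicCompletion L)) 0 0)) * b'' ∈ Λ) →
      IsOrd ρ α (jE ϖ ^ j) lam → jE r = glueUnit ρ Θ α (jE ϖ ^ j) h (jE ϖ) (jE 1) x₀ b' →
      f b' j Λ = Nat.card {x : 𝒪[(w.1.adicCompletion L)] ⧸ 𝓂[(w.1.adicCompletion L)] ^ (2 * b') //
        ∃ u' : 𝒪[(w.1.adicCompletion L)], Ideal.Quotient.mk (𝓂[(w.1.adicCompletion L)] ^ (2 * b')) u' = x ∧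
          Valued.v ((u' : (w.1.adicCompletion L)) * (galAdicCompletionMap (L := L) (IsCMField.complexConj L) hw) u' - r) ≤ Valued.v (ϖ ^ (2 * b'))})
    {dρ tρ : ℕ} (hDρ : IsRamifiedQuadraticDatum ρ α dρ tρ) (hϖM : Valued.v (jE ϖ) = WithZero.exp (-2 : ℤ)) {m₂ : ℕ}
    (hm₂ : Valued.v ((jE ϖ ^ b)⁻¹ * ((lam - 1) * (lam - 1) - jE (((u : Matrix (Fin 1) (Fin 1) (w.1.adicCompletion L)) 0 0 - 1) ^ 2))) = Valued.v (jE ϖ) ^ m₂ * Valued.v α)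
    {jl : ℕ} (hjl : Valued.v (lam - ρ lam) = Valued.v (jE ϖ) ^ jl * Valued.v (α - ρ α))
    (hlev : Valued.v (lam - 1) ≤ Valued.v (jE ϖ ^ a)) (hajl : a ≤ jl) (hlev2 : Valued.v ((lam - 1) * (lam - 1)) ≤ Valued.v (jE ϖ ^ b))
    (hdeep : Valued.v (lam + ρ lam - 2) ≤ Valued.v (jE ϖ) ^ (b - a)) :
    {M₃ : Submodule (Valued.integer (w.1.adicCompletion L)) (Fin 3 → (w.1.adicCompletion L)) |
        IsVertexLattice (galAdicCompletionMap (L := L) (IsCMField.complexConj L) hw) ϖ ((StdForm.antidiagonal 3).over (w.1.adicCompletion L)) 0 M₃ ∧ mapGL (endoGL (γ₂, u)) M₃ = M₃ ∧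
          (LatticeInLevel ϖ a (((endoGL (γ₂, u) : GL (Fin 3) (w.1.adicCompletion L)) : Matrix (Fin 3) (Fin 3) (w.1.adicCompletion L)) - 1) M₃ ∧
            LatticeInLevel ϖ b ((((endoGL (γ₂, u) : GL (Fin 3) (w.1.adicCompletion L)) : Matrix (Fin 3) (Fin 3) (w.1.adicCompletion L)) - 1) *
              (((endoGL (γ₂, u) : GL (Fin 3) (w.1.adicCompletion L)) : Matrix (Fin 3) (Fin 3) (w.1.adicCompletion L)) - 1)) M₃)}.ncard =
      (∑ j ∈ Finset.range (jl - a + 1), (levelSet ρ Θ α (jE ϖ) h j 0).ncard) +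
        ∑ b' ∈ Finset.Icc 1 R, ∑ j ∈ Finset.range (jl - a + 1),
          (if j + b' ≤ m₂ then
            ∑ᶠ Λ ∈ levelSetDep ρ Θ α (jE ϖ) h j b' ((jE ϖ ^ a)⁻¹ * (lam - jE ((u : Matrix (Fin 1) (Fin 1) (w.1.adicCompletion L)) 0 0))), f b' j Λ else 0) := by
  have hϖv : Valued.v (jE ϖ) ≠ 0 := by rw [hϖM]; exact WithZero.exp_ne_zero
  have hϖE0 : jE ϖ ≠ 0 := fun h0 => by rw [h0, map_zero] at hϖv; exact hϖv rfl
  have hϖE1 : Valued.v (jE ϖ) < 1 := by rw [hϖM, ← WithZero.exp_zero, WithZero.exp_lt_exp]; norm_num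
  have hρϖ : ρ (jE ϖ) = jE ϖ := (hjfix _).2 ⟨ϖ, rfl⟩
  have hρc : ρ (jE ϖ ^ a) = jE ϖ ^ a := by rw [map_pow, hρϖ]
  have hρc' : ρ (jE ϖ ^ b) = jE ϖ ^ b := by rw [map_pow, hρϖ]
  have hca : Valued.v (jE ϖ ^ a) = Valued.v (jE ϖ) ^ a := map_pow _ _ _
  have hcb : Valued.v (jE ϖ ^ b) = Valued.v (jE ϖ) ^ b := map_pow _ _ _
  have hjlJ : jl ≤ J := by
    have h' := (isOrd_pow_iff_le hα hϖE0 hϖE1 hlam.le hjl (J + 1)).not.1 hJ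
    omega
  have h21 : Valued.v (2 : M) ≤ 1 := by
    rw [show (2 : M) = 1 + 1 by norm_num]; exact (Valuation.map_add _ _ _).trans (by rw [Valuation.map_one, max_self])
  have hxpow : lam + ρ lam - 2 ≠ 0 → ∃ n : ℕ, Valued.v (lam + ρ lam - 2) = Valued.v (jE ϖ) ^ n := fun hx =>
    hEval _ (by rw [map_sub, map_add, hρρ, map_ofNat]; ring) hx
      ((Valuation.map_sub _ _ _).trans (max_le ((Valuation.map_add _ _ _).trans (max_le hlam.le (by rw [hvρ]; exact hlam.le))) h21))
  rw [ncard_typeZero_fixed_endoGL_levels_eq_guardedForm L w hw hϖ jE hρρ hvρ hα hα1 hint hΘΘ hΘρ hvΘ hΘj hjv hjfix hjpow hEval hϖmax φ hφs hφi hφo γ₂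
    hφγ hlam hΘh hh hform u hΓ hu a b huc huc2 hfinF hR hJ hfinLS f hf _
    (fun j b' => finsum_mem_inter_levelSetDep_eq_ramified_odd hDρ hΘΘ hΘρ hvΘ hρϖ hϖM hh _ hm₂ j b' (f b' j))]
  congr 1
  · exact sum_ite_isOrd₃_eq_sum_range_of_deep' hα hϖE0 hϖE1 hlam.le hjl hρc hca hlev hajl hρc' hcb hlev2 hxpow hdeep hjlJ _
  · refine Finset.sum_congr rfl fun b' _ => ?_
    rw [sum_ite_isOrd₃_eq_sum_range_of_deep' hα hϖE0 hϖE1 hlam.le hjl hρc hca hlev hajl hρc' hcb hlev2 hxpow hdeep hjlJ]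

/-! ## §2 The anisotropic literal -/

/-- **(C2-lev-cutoff-CM-RamM, ODD), ANISOTROPIC LITERAL `P₁·endoGL (γ₁, u)·P₁⁻¹`.**  ★ p859485 §2's binders VERBATIM (universe-`0` `M`) with `hcell :=` ★ (R0)'s odd cell,
plus the ramified datum, the odd token of `μ₂`, the token `jl`, the deep trace token and the level letters; cone guard `j + b′ ≤ m₂`. [cite: Serre1979, Ch. III §6 Prop. 12]
[cite: Kottwitz1986BaseChangeUnits, §1 pp. 240–241] [cite: Rogawski1990, §4.9 Prop. 4.9.1 (a)(b) pp. 54–55] [cite: Jacobowitz1962, §4] [cite: Flicker1998UnitaryFL, Prop. 7 p. 84] -/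
theorem ncard_typeZero_fixed_conj_endoGL_levels_eq_cutoff_ramM_odd (L : Type) [Field L] [NumberField L] [IsCMField L]
    {v : HeightOneSpectrum (𝓞 ↥(maximalRealSubfield L))} (w : UnitaryGroup.PlacesOver L v)
    (hw : IsCMField.complexConj L • w.1 = w.1) {ϖ : (w.1.adicCompletion L)} (hϖ : Valued.v ϖ = WithZero.exp (-1 : ℤ))
    {M : Type} [Field M] [Valued M ℤᵐ⁰] {ρ Θ : M →+* M} {α : M} (jE : (w.1.adicCompletion L) →+* M)
    (hρρ : ∀ x, ρ (ρ x) = x) (hvρ : ∀ x, Valued.v (ρ x) = Valued.v x) (hα : ρ α ≠ α) (hα1 : Valued.v α ≤ 1)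
    (hint : ∀ z : M, Valued.v z ≤ 1 → Valued.v ((z - ρ z) / (α - ρ α)) ≤ 1)
    (hΘΘ : ∀ x, Θ (Θ x) = x) (hΘρ : ∀ x, Θ (ρ x) = ρ (Θ x)) (hvΘ : ∀ x, Valued.v (Θ x) = Valued.v x)
    (hΘj : ∀ x, Θ (jE x) = jE ((galAdicCompletionMap (L := L) (IsCMField.complexConj L) hw) x))
    (hjv : ∀ c, Valued.v (jE c) ≤ 1 ↔ Valued.v c ≤ 1) (hjfix : ∀ z, ρ z = z ↔ ∃ c, jE c = z)
    (hjpow : ∀ (t : (w.1.adicCompletion L)) (n : ℤ), Valued.v (jE t) = Valued.v (jE ϖ) ^ n ↔ Valued.v t = Valued.v ϖ ^ n)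
    (hEval : ∀ c : M, ρ c = c → c ≠ 0 → Valued.v c ≤ 1 → ∃ n : ℕ, Valued.v c = Valued.v (jE ϖ) ^ n)
    (hϖmax : ∀ t : M, ρ t = t → Valued.v t < 1 → Valued.v t ≤ Valued.v (jE ϖ))
    (P₁ : GL (Fin 3) (w.1.adicCompletion L)) (dg : Fin 2 → (w.1.adicCompletion L)) (η : (w.1.adicCompletion L))
    (γ₁ : GL (Fin 2) (w.1.adicCompletion L)) (u : GL (Fin 1) (w.1.adicCompletion L))
    (hfc : formCongr (galAdicCompletionMap (L := L) (IsCMField.complexConj L) hw) P₁ (placeForm (Matrix.of fun i j : Fin 3 => if i.val + j.val + 1 = 3 then (1 : L) else 0) w.1) =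
      (!![(Matrix.diagonal dg) 0 0, 0, (Matrix.diagonal dg) 0 1; 0, η, 0; (Matrix.diagonal dg) 1 0, 0, (Matrix.diagonal dg) 1 1] : Matrix (Fin 3) (Fin 3) (w.1.adicCompletion L)))
    (hdg1 : ∀ i, Valued.v (dg i) = 1) (hdgσ : ∀ i, (galAdicCompletionMap (L := L) (IsCMField.complexConj L) hw) (dg i) = dg i)
    (hησ : (galAdicCompletionMap (L := L) (IsCMField.complexConj L) hw) η = η) (hη1 : Valued.v η = 1)
    (hmem : P₁ * endoGL (γ₁, u) * P₁⁻¹ ∈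
      unitaryGroupOfForm (galAdicCompletionMap (L := L) (IsCMField.complexConj L) hw) (placeForm (Matrix.of fun i j : Fin 3 => if i.val + j.val + 1 = 3 then (1 : L) else 0) w.1))
    (hu : Valued.v ((u : Matrix (Fin 1) (Fin 1) (w.1.adicCompletion L)) 0 0) = 1) (a b : ℕ)
    (huc : Valued.v ((u : Matrix (Fin 1) (Fin 1) (w.1.adicCompletion L)) 0 0 - 1) ≤ Valued.v ϖ ^ a)
    (huc2 : Valued.v (((u : Matrix (Fin 1) (Fin 1) (w.1.adicCompletion L)) 0 0 - 1) ^ 2) ≤ Valued.v ϖ ^ b)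
    (φ : (Fin 2 → (w.1.adicCompletion L)) →+ M) (hφs : ∀ (c : (w.1.adicCompletion L)) (x : Fin 2 → (w.1.adicCompletion L)), φ (c • x) = jE c * φ x)
    (hφi : Function.Injective φ) (hφo : Function.Surjective φ)
    {lam h : M} (hφγ : ∀ x, φ ((γ₁ : Matrix (Fin 2) (Fin 2) (w.1.adicCompletion L)).mulVec x) = lam * φ x) (hlam : Valued.v lam = 1)
    (hΘh : Θ h = h) (hh : h ≠ 0)
    (hform : ∀ x y, jE (pairing (galAdicCompletionMap (L := L) (IsCMField.complexConj L) hw) (Matrix.diagonal dg) x y) = h * Θ (φ x) * φ y + ρ (h * Θ (φ x) * φ y))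
    {R : ℕ}
    (hfinF : {M₃ : Submodule (Valued.integer (w.1.adicCompletion L)) (Fin 3 → (w.1.adicCompletion L)) |
      IsSelfDualLattice (galAdicCompletionMap (L := L) (IsCMField.complexConj L) hw) ϖ
        (!![(Matrix.diagonal dg) 0 0, 0, (Matrix.diagonal dg) 0 1; 0, η, 0; (Matrix.diagonal dg) 1 0, 0, (Matrix.diagonal dg) 1 1] : Matrix (Fin 3) (Fin 3) (w.1.adicCompletion L)) M₃ ∧
      mapGL (endoGL (γ₁, u)) M₃ = M₃}.Finite)
    (hR : ∀ M₃ : Submodule (Valued.integer (w.1.adicCompletion L)) (Fin 3 → (w.1.adicCompletion L)),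
      IsSelfDualLattice (galAdicCompletionMap (L := L) (IsCMField.complexConj L) hw) ϖ
        (!![(Matrix.diagonal dg) 0 0, 0, (Matrix.diagonal dg) 0 1; 0, η, 0; (Matrix.diagonal dg) 1 0, 0, (Matrix.diagonal dg) 1 1] : Matrix (Fin 3) (Fin 3) (w.1.adicCompletion L)) M₃ →
      mapGL (endoGL (γ₁, u)) M₃ = M₃ → ∀ b' : ℕ, (∀ c : (w.1.adicCompletion L), (Pi.single 1 c : Fin 3 → (w.1.adicCompletion L)) ∈ M₃ ↔ Valued.v c ≤ Valued.v ϖ ^ b') → b' ≤ R)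
    {J : ℕ} (hJ : ¬ IsOrd ρ α (jE ϖ ^ (J + 1)) lam) (hfinLS : ∀ j a', (levelSet ρ Θ α (jE ϖ) h j a').Finite)
    (f : ℕ → ℕ → AddSubgroup M → ℕ)
    (hf : ∀ (b' j : ℕ) (Λ : AddSubgroup M) (x₀ : M) (r : (w.1.adicCompletion L)), 1 ≤ b' → x₀ ≠ 0 →
      (∀ x, x ∈ Λ ↔ ∃ z, IsOrd ρ α (jE ϖ ^ j) z ∧ x = x₀ * z) →
      IsOrd ρ α (jE ϖ ^ j) (dualGen ρ Θ α (jE ϖ ^ j) h x₀) → ¬ IsOrd ρ α (jE ϖ ^ j) (dualGen ρ Θ α (jE ϖ ^ j) h x₀ / jE ϖ) →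
      Valued.v (dualGen ρ Θ α (jE ϖ ^ j) h x₀) = Valued.v (jE ϖ) ^ b' →
      (∀ b'', (∀ x ∈ Λ, Valued.v (h * Θ x * b'' + ρ (h * Θ x * b'')) ≤ 1) → (lam - jE ((u : Matrix (Fin 1) (Fin 1) (w.1.adicCompletion L)) 0 0)) * b'' ∈ Λ) →
      IsOrd ρ α (jE ϖ ^ j) lam → jE r = glueUnit ρ Θ α (jE ϖ ^ j) h (jE ϖ) (jE η) x₀ b' →
      f b' j Λ = Nat.card {x : 𝒪[(w.1.adicCompletion L)] ⧸ 𝓂[(w.1.adicCompletion L)] ^ (2 * b') //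
        ∃ u' : 𝒪[(w.1.adicCompletion L)], Ideal.Quotient.mk (𝓂[(w.1.adicCompletion L)] ^ (2 * b')) u' = x ∧
          Valued.v ((u' : (w.1.adicCompletion L)) * (galAdicCompletionMap (L := L) (IsCMField.complexConj L) hw) u' - r) ≤ Valued.v (ϖ ^ (2 * b'))})
    {dρ tρ : ℕ} (hDρ : IsRamifiedQuadraticDatum ρ α dρ tρ) (hϖM : Valued.v (jE ϖ) = WithZero.exp (-2 : ℤ)) {m₂ : ℕ}
    (hm₂ : Valued.v ((jE ϖ ^ b)⁻¹ * ((lam - 1) * (lam - 1) - jE ((((u : Matrix (Fin 1) (Fin 1) (w.1.adicCompletion L)) 0 0) - 1) ^ 2))) = Valued.v (jE ϖ) ^ m₂ * Valued.v α)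
    {jl : ℕ} (hjl : Valued.v (lam - ρ lam) = Valued.v (jE ϖ) ^ jl * Valued.v (α - ρ α))
    (hlev : Valued.v (lam - 1) ≤ Valued.v (jE ϖ ^ a)) (hajl : a ≤ jl) (hlev2 : Valued.v ((lam - 1) * (lam - 1)) ≤ Valued.v (jE ϖ ^ b))
    (hdeep : Valued.v (lam + ρ lam - 2) ≤ Valued.v (jE ϖ) ^ (b - a)) :
    {M₃ : Submodule (Valued.integer (w.1.adicCompletion L)) (Fin 3 → (w.1.adicCompletion L)) |
        IsVertexLattice (galAdicCompletionMap (L := L) (IsCMField.complexConj L) hw) ϖ ((StdForm.antidiagonal 3).over (w.1.adicCompletion L)) 0 M₃ ∧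
        mapGL (P₁ * endoGL (γ₁, u) * P₁⁻¹) M₃ = M₃ ∧
          (LatticeInLevel ϖ a (((P₁ * endoGL (γ₁, u) * P₁⁻¹ : GL (Fin 3) (w.1.adicCompletion L)) : Matrix (Fin 3) (Fin 3) (w.1.adicCompletion L)) - 1) M₃ ∧
            LatticeInLevel ϖ b ((((P₁ * endoGL (γ₁, u) * P₁⁻¹ : GL (Fin 3) (w.1.adicCompletion L)) : Matrix (Fin 3) (Fin 3) (w.1.adicCompletion L)) - 1) *
              (((P₁ * endoGL (γ₁, u) * P₁⁻¹ : GL (Fin 3) (w.1.adicCompletion L)) : Matrix (Fin 3) (Fin 3) (w.1.adicCompletion L)) - 1)) M₃)}.ncard =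
      (∑ j ∈ Finset.range (jl - a + 1), (levelSet ρ Θ α (jE ϖ) h j 0).ncard) +
        ∑ b' ∈ Finset.Icc 1 R, ∑ j ∈ Finset.range (jl - a + 1),
          (if j + b' ≤ m₂ then
            ∑ᶠ Λ ∈ levelSetDep ρ Θ α (jE ϖ) h j b' ((jE ϖ ^ a)⁻¹ * (lam - jE ((u : Matrix (Fin 1) (Fin 1) (w.1.adicCompletion L)) 0 0))), f b' j Λ else 0) := by
  have hϖv : Valued.v (jE ϖ) ≠ 0 := by rw [hϖM]; exact WithZero.exp_ne_zero
  have hϖE0 : jE ϖ ≠ 0 := fun h0 => by rw [h0, map_zero] at hϖv; exact hϖv rfl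
  have hϖE1 : Valued.v (jE ϖ) < 1 := by rw [hϖM, ← WithZero.exp_zero, WithZero.exp_lt_exp]; norm_num
  have hρϖ : ρ (jE ϖ) = jE ϖ := (hjfix _).2 ⟨ϖ, rfl⟩
  have hρc : ρ (jE ϖ ^ a) = jE ϖ ^ a := by rw [map_pow, hρϖ]
  have hρc' : ρ (jE ϖ ^ b) = jE ϖ ^ b := by rw [map_pow, hρϖ]
  have hca : Valued.v (jE ϖ ^ a) = Valued.v (jE ϖ) ^ a := map_pow _ _ _
  have hcb : Valued.v (jE ϖ ^ b) = Valued.v (jE ϖ) ^ b := map_pow _ _ _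
  have hjlJ : jl ≤ J := by
    have h' := (isOrd_pow_iff_le hα hϖE0 hϖE1 hlam.le hjl (J + 1)).not.1 hJ
    omega
  have h21 : Valued.v (2 : M) ≤ 1 := by
    rw [show (2 : M) = 1 + 1 by norm_num]; exact (Valuation.map_add _ _ _).trans (by rw [Valuation.map_one, max_self])
  have hxpow : lam + ρ lam - 2 ≠ 0 → ∃ n : ℕ, Valued.v (lam + ρ lam - 2) = Valued.v (jE ϖ) ^ n := fun hx =>
    hEval _ (by rw [map_sub, map_add, hρρ, map_ofNat]; ring) hx
      ((Valuation.map_sub _ _ _).trans (max_le ((Valuation.map_add _ _ _).trans (max_le hlam.le (by rw [hvρ]; exact hlam.le))) h21))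
  rw [ncard_typeZero_fixed_conj_endoGL_levels_eq_guardedForm L w hw hϖ jE hρρ hvρ hα hα1 hint hΘΘ hΘρ hvΘ hΘj hjv hjfix hjpow hEval hϖmax P₁ dg η γ₁ u hfc
    hdg1 hdgσ hησ hη1 hmem hu a b huc huc2 φ hφs hφi hφo hφγ hlam hΘh hh hform hfinF hR hJ hfinLS f hf _
    (fun j b' => finsum_mem_inter_levelSetDep_eq_ramified_odd hDρ hΘΘ hΘρ hvΘ hρϖ hϖM hh _ hm₂ j b' (f b' j))]
  congr 1
  · exact sum_ite_isOrd₃_eq_sum_range_of_deep' hα hϖE0 hϖE1 hlam.le hjl hρc hca hlev hajl hρc' hcb hlev2 hxpow hdeep hjlJ _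
  · refine Finset.sum_congr rfl fun b' _ => ?_
    rw [sum_ite_isOrd₃_eq_sum_range_of_deep' hα hϖE0 hϖE1 hlam.le hjl hρc hca hlev hajl hρc' hcb hlev2 hxpow hdeep hjlJ]

end Summit.HodgeConjecture.HodgeConjecture.Cruxes.H413.F0P3cDyRamLevelsCensusCutoffCMRamMOdd

end
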